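import Literature.Probability.LatticeModels.BoxDirichlet
import HarnessLib

/-!
# Differences of lattice-harmonic functions are lattice harmonic; the interior second-difference estimate on boxes

Topic `Literature/Probability/LatticeModels` (discrete potential theory on `ℤ²`, continuing
`BoxDirichlet.lean`). Lawler–Schramm–Werner (Ann. Probab. 32 (2004), Lemma 5.2; arXiv:math/0112234
p. 27) bound the iterated discrete derivatives `∂_{a_1}⋯∂_{a_k} h` of a nonnegative harmonic `h`
("Only `k ≤ 3` will be used"; their proof of Lemma 5.3 then passes discrete derivatives of all
orders to the limit: "The fact that `h^n` is discrete-harmonic translates to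
`(∂_x^δ)² h^n(v-δ) + (∂_y^δ)² h^n(v-iδ) = 0`"). The induction rests on two facts recorded here for
the tree's nearest-neighbour Laplacian (`latticeLaplacian`, `IsLatticeHarmonicOn`):

* `latticeLaplacian_shift`, **`IsLatticeHarmonicOn.diff`** — translation commutes with the
  Laplacian, so the difference `D_k h = h(· + e_k) - h` of a function harmonic on `U` is harmonic
  wherever both `y` and `y + e_k` lie in `U`;
* **`harmonic_box_second_difference_le`** — the second-order interior estimate (Lawler–Limic 2010,
  Thm. 6.3.8 iterated): if `h` is harmonic on the interior of the box of side `4m` (`m ≥ 8`) with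
  `|h| ≤ M` on its four open sides, then on the middle of the concentric box of side `2m`,
  `|D_j D_k h| ≤ 2K² M / m²` (`K = topGradConst`): the first differences are `≤ KM/m` on the
  middle of the big box (`harmonic_box_gradient_le`), which contains the sides of the small box,
  on whose interior `D_k h` is harmonic, and the gradient estimate applies again.

## References

* G. F. Lawler, O. Schramm, W. Werner, Ann. Probab. 32 (2004) 939–995, Lemmas 5.1–5.3
  [LawlerSchrammWerner2004].
* G. F. Lawler, V. Limic, *Random Walk: A Modern Introduction* (2010), Thm. 6.3.8 [LawlerLimic2010].
-/

noncomputable section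

namespace Literature.Probability.LatticeModels

open Set

/-! ### Translation and differences -/

/-- The lattice Laplacian commutes with translations. [folklore] -/
theorem latticeLaplacian_shift (h : Site 2 → ℝ) (e y : Site 2) :
    latticeLaplacian (fun z => h (z + e)) y = latticeLaplacian h (y + e) := by
  simp only [latticeLaplacian, add_right_comm]

/-- A translate of a harmonic function is harmonic on the translated set. [folklore] -/
theorem IsLatticeHarmonicOn.shift {h : Site 2 → ℝ} {U : Set (Site 2)} (hh : IsLatticeHarmonicOn h U)
    (e : Site 2) : IsLatticeHarmonicOn (fun z => h (z + e)) {y | y + e ∈ U} := by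
  intro y hy
  rw [latticeLaplacian_shift]
  exact hh _ hy

/-- **The discrete derivative of a harmonic function is harmonic**: `D_e h = h(· + e) - h` is
lattice harmonic at every `y` with `y ∈ U` and `y + e ∈ U`. (LSW04, proof of Lemma 5.2: "Since
`∂_{a_k}^δ h` is discrete-harmonic on `V` …".) [cite: LawlerSchrammWerner2004, Lemma 5.2 (proof)] -/
theorem IsLatticeHarmonicOn.diff {h : Site 2 → ℝ} {U : Set (Site 2)} (hh : IsLatticeHarmonicOn h U)
    (e : Site 2) : IsLatticeHarmonicOn (fun z => h (z + e) - h z) {y | y ∈ U ∧ y + e ∈ U} := by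
  intro y hy
  have h1 := hh.shift e y hy.2
  have h2 := hh y hy.1
  rw [show (fun z => h (z + e) - h z) = (fun z => h (z + e)) - h from rfl, latticeLaplacian_sub,
    h1, h2, sub_zero]

/-! ### The second-difference estimate on boxes -/

/-- The four elements of `Fin 4`. [folklore] -/
private theorem fin4_cases' (k : Fin 4) : k = 0 ∨ k = 1 ∨ k = 2 ∨ k = 3 := by
  revert k; decide

/-- Coordinates of `cornerUnit k` are in `{-1, 0, 1}`. [folklore] -/
theorem cornerUnit_coord_mem (k : Fin 4) (i : Fin 2) :
    cornerUnit k i = 0 ∨ cornerUnit k i = 1 ∨ cornerUnit k i = -1 := by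
  rcases fin4_cases' k with rfl | rfl | rfl | rfl <;> fin_cases i <;> simp [cornerUnit]

/-- **Interior second-difference estimate** (Lawler–Limic Thm 6.3.8 iterated; the `k = 2` step
of LSW04 Lemma 5.2): let `h` be lattice harmonic on the interior of the box of side `4m` with
lower-left corner `a` (`m ≥ 8`) and `|h| ≤ M` on its four open sides. Then for `x` in the middle
of the concentric box of side `2m` (corner `a + (m, m)`) and all directions `j, k`,
`|(h(x + e_j + e_k) - h(x + e_j)) - (h(x + e_k) - h(x))| ≤ 2 K² M / m²`, `K = topGradConst`.
[cite: LawlerSchrammWerner2004, Lemma 5.2] -/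
theorem harmonic_box_second_difference_le {h : Site 2 → ℝ} {a : Site 2} {m : ℕ} (hm : 8 ≤ m)
    (hh : IsLatticeHarmonicOn h (boxInterior a (4 * m))) {M : ℝ} (hM0 : 0 ≤ M)
    (hM : ∀ i : ℕ, 0 < i → i < 4 * m →
      |h ![a 0 + i, a 1 + (4 * m : ℕ)]| ≤ M ∧ |h ![a 0 + i, a 1]| ≤ M ∧ |h ![a 0, a 1 + i]| ≤ M ∧
        |h ![a 0 + (4 * m : ℕ), a 1 + i]| ≤ M)
    {x : Site 2} (hx : x ∈ boxMiddle (![a 0 + m, a 1 + m]) (2 * m)) (j k : Fin 4) :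
    |(h (x + cornerUnit j + cornerUnit k) - h (x + cornerUnit j)) - (h (x + cornerUnit k) - h x)| ≤
      2 * topGradConst ^ 2 * M / m ^ 2 := by
  set N : ℕ := 4 * m with hN
  have hN16 : 16 ≤ N := by omega
  -- first differences on the middle of the big box
  have hgrad : ∀ y ∈ boxMiddle a N, ∀ k : Fin 4, |h (y + cornerUnit k) - h y| ≤ 4 * topGradConst * M / N :=
    fun y hy k => harmonic_box_gradient_le a N hN16 hh hM0 hM hy k
  -- the inner box: corner `a' = a + (m, m)`, side `N' = 2m`
  set a' : Site 2 := ![a 0 + m, a 1 + m] with ha'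
  have ha'0 : a' 0 = a 0 + m := rfl
  have ha'1 : a' 1 = a 1 + m := rfl
  set N' : ℕ := 2 * m with hN'
  have hN'16 : 16 ≤ N' := by omega
  -- `D_k h` is harmonic on the interior of the inner box
  set g : Site 2 → ℝ := fun z => h (z + cornerUnit k) - h z with hg
  have hck0 := cornerUnit_coord_mem k 0
  have hck1 := cornerUnit_coord_mem k 1
  have hinner : ∀ y ∈ boxInterior a' N', y ∈ boxInterior a N ∧ y + cornerUnit k ∈ boxInterior a N := by
    intro y hy
    obtain ⟨h1, h2, h3, h4⟩ := hy
    rw [ha'0] at h1 h2; rw [ha'1] at h3 h4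
    have e0 : (y + cornerUnit k) 0 = y 0 + cornerUnit k 0 := rfl
    have e1 : (y + cornerUnit k) 1 = y 1 + cornerUnit k 1 := rfl
    refine ⟨⟨by omega, by omega, by omega, by omega⟩, ?_⟩
    simp only [boxInterior, mem_setOf_eq, e0, e1]
    rcases hck0 with h0 | h0 | h0 <;> rcases hck1 with h1' | h1' | h1' <;> omega
  have hgharm : IsLatticeHarmonicOn g (boxInterior a' N') := fun y hy => (hh.diff (cornerUnit k)) y (hinner y hy)
  -- bound on the sides of the inner box: they lie in the middle of the big box
  set M₁ : ℝ := 4 * topGradConst * M / N with hM₁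
  have hM₁0 : 0 ≤ M₁ := by
    have := topGradConst_pos
    positivity
  have hmid : ∀ y : Site 2, a 0 + m ≤ y 0 → y 0 ≤ a 0 + 3 * m → a 1 + m ≤ y 1 → y 1 ≤ a 1 + 3 * m →
      y ∈ boxMiddle a N := by
    intro y h1 h2 h3 h4
    simp only [boxMiddle, mem_setOf_eq, hN]
    push_cast
    omega
  have hsides : ∀ i : ℕ, 0 < i → i < N' →
      |g ![a' 0 + i, a' 1 + (N' : ℕ)]| ≤ M₁ ∧ |g ![a' 0 + i, a' 1]| ≤ M₁ ∧ |g ![a' 0, a' 1 + i]| ≤ M₁ ∧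
        |g ![a' 0 + (N' : ℕ), a' 1 + i]| ≤ M₁ := by
    intro i hi hiN
    have hi' : (0 : ℤ) < i := by exact_mod_cast hi
    have hiN2 : (i : ℤ) < 2 * m := by rw [hN'] at hiN; exact_mod_cast hiN
    refine ⟨hgrad _ (hmid _ ?_ ?_ ?_ ?_) k, hgrad _ (hmid _ ?_ ?_ ?_ ?_) k, hgrad _ (hmid _ ?_ ?_ ?_ ?_) k,
      hgrad _ (hmid _ ?_ ?_ ?_ ?_) k⟩
    all_goals simp only [ha'0, ha'1, hN', Matrix.cons_val_zero, Matrix.cons_val_one, Nat.cast_mul,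
      Nat.cast_ofNat]
    all_goals omega
  -- `x` lies in the middle of the inner box: the gradient estimate for `g`
  have key := harmonic_box_gradient_le a' N' hN'16 hgharm hM₁0 hsides hx j
  -- rewrite `g (x + e_j) - g x` and the constant
  have hmr : (0 : ℝ) < m := by exact_mod_cast (show 0 < m by omega)
  have hgx : g (x + cornerUnit j) - g x =
      (h (x + cornerUnit j + cornerUnit k) - h (x + cornerUnit j)) - (h (x + cornerUnit k) - h x) := rfl
  rw [hgx] at key
  calc _ ≤ 4 * topGradConst * M₁ / N' := key
    _ = 2 * topGradConst ^ 2 * M / m ^ 2 := by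
        rw [hM₁, hN, hN']; push_cast; field_simp; ring

end Literature.Probability.LatticeModels
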